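import Literature.AnabelianGeometry.EtaleTheta.Discharge.Sec2Cor219iiiTransport
import HarnessLib

/-!
# [EtTh] Cor. 2.19 (iii), tower form (`ThetaEnvTower.Cor219_iii`, F-0650) — transport toolkit, part 2b (GENERIC):
# the TRANSPORT `f ↦ γ̃⁻¹ ∘ f ∘ γ` of `l·Δ_Θ`-valued cocycles along an automorphism of `Π^tp_X̲̲` and its reduction
# mod `M` = the row's `pullbackCocycle` (proof-only)

S. Mochizuki, *The étale theta function and its Frobenioid-theoretic manifestations*, Publ. RIMS **45** (2009)
[EtTh], §2, Cor. 2.19 (iii), PRIMS PDF p. 65 ("an arbitrary automorphism of `Π^tp_X` preserves this collection of classes …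
[after] composition with the automorphism of `(l·Δ_Θ) ⊗ ℤ/Nℤ` it induces"); Cor. 2.18 (i) p. 60 [cite: MochizukiEtTh2009, Cor 2.19(iii) p.65].

Cell `abc-iut`, seat abc-iut-w4-d038 (gen 9), K-L6 / C-R33 row «COR219III-AT-MODELTATE», PART 2b — roadmap items G3/G4
(HOME/staging/L6/w4-d038/g9/COR219III-PART2-ROADMAP.md), GENERIC over every §1 setting.  PROOF-ONLY: no definition, no
instance, no notation, no new named fact; sequel of this seat's `Sec2Cor219iiiTransport` (G1/G1′/G2/G2′/G7) and
`Sec2Cor219iiiInnerAut` (PART 1); abc-iut-L2-t8 / L2-t2 / L2-t1 vocabulary consumed BY NAME.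

WHAT IS SHOWN (`T := C.thetaEnvTower τ hC hS`; `γ` a bi-continuous automorphism of `Π^tp_X̲̲` stabilising `Π^tp_Ÿ̲̲` and the
inverse image of `l·Δ_Θ`; `γ̃` an automorphism of `l·Δ_Θ` induced by `γ` — `Sec2Cor219iiiTransport.exists_lDeltaAut`):
* `exists_transport` (G3+G4) — for every `l·Δ_Θ`-valued continuous cocycle `f` on `Π^tp_Ÿ̲̲` the TRANSPORT
  `Φ_γ f : g ↦ γ̃⁻¹(f(γ g))` exists as an `l·Δ_Θ`-valued function satisfying the cocycle law for the ORIGINAL conjugation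
  action (by the equivariance `lDeltaAut_conj` of `γ̃`), and its reduction mod `M` IS abc-iut-L2-t2's
  `ThetaEnvTower.pullbackCocycle M γ hγ γ̄_M (red_M ∘ f)` for every admitted coefficient automorphism `γ̄_M` (pinning, G1).
So the pulled-back mod-`M` collections of the row are the reductions of transported root cocycles; what remains generic is
the level-wise assembly (G8) from the model heart (M1–M3).

v2 (append-only, §2 = roadmap G5/G6): `lDeltaAut_symm_conj` (`γ̃⁻¹` intertwines the conjugations through `γ`),
`transport_conj` (G5: the transport of `conjRoot σ f` is `conjRoot (γ⁻¹σ)` of the transport of `f`, pointwise) and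
`transport_coboundary` (G6: the transport of the coboundary of `d ∈ l·Δ_Θ` is the coboundary of `γ̃⁻¹ d`).

HONEST FRAMING: unconditional statements about OUR typed objects over an arbitrary §1 setting; nothing of [EtTh] (refereed)
is asserted beyond what is proved; no side is taken on [IUTchIII] Cor. 3.12; typed ≠ proved; nothing asserts abc proved or
refuted.
-/

noncomputable section

namespace Literature.AnabelianGeometry.EtaleTheta

open Literature.AnabelianGeometry.SemiGraphs

namespace ThetaSetting.EtaleThetaData.DoubleUnderline

variable {p : ℕ} [Fact p.Prime] {D : ThetaSetting p} {E : D.EtaleThetaData} {l : ℕ}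
  (C : E.DoubleUnderline l) {Es : Set ℕ+} (τ : D.CyclotomeTower l Es)

/-- `Π^tp_X̲̲ ∩ θ⁻¹(l·Δ_Θ) ↠ l·Δ_Θ` is onto — private copy (statement of `DoubleUnderline.toLDelta_surjective`, abc-iut
`Discharge/Sec5Prop55HPprojAtSettingQ`, re-proved from `map_toTheta_Huu` to keep the import closure in §2).
[cite: MochizukiEtTh2009, Prop 2.12 (i) p.45] -/
private theorem toLDelta_onto' : Function.Surjective C.toLDelta := by
  intro a
  have ha : (a : D.GtpTheta) ∈ C.Huu.map D.toTheta ⊓ D.DeltaTheta := by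
    rw [C.map_toTheta_Huu]; exact a.2
  obtain ⟨⟨h, hh, hha⟩, -⟩ := ha
  refine ⟨⟨⟨h, hh⟩, ?_⟩, Subtype.ext ?_⟩
  · rw [Subgroup.mem_comap, MonoidHom.coe_comp, Function.comp_apply, Subgroup.coe_subtype, hha]
    exact a.2
  · rw [coe_toLDelta]
    exact hha

/-- **G4 (pinning on values).** For `γ` preserving the inverse image of `l·Δ_Θ`, an induced `γ̃` on `l·Δ_Θ` and an admitted
coefficient automorphism `γ̄_M`: `γ̄_M (red_M (γ̃⁻¹ y)) = red_M y` for every `y ∈ l·Δ_Θ` — i.e. `γ̄_M⁻¹ ∘ red_M = red_M ∘ γ̃⁻¹`.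
[cite: MochizukiEtTh2009, Cor 2.19(iii) p.65] -/
theorem coeffAut_red_lDeltaAut_symm (hC : D.Compat) (hS : D.Sec2Hyps) (M : Es)
    (γ : (C.thetaEnvTower τ hC hS).PiX ≃ₜ* (C.thetaEnvTower τ hC hS).PiX)
    (hγL : ∀ g : (C.thetaEnvTower τ hC hS).lDeltaTheta,
      γ (g : (C.thetaEnvTower τ hC hS).PiX) ∈ (C.thetaEnvTower τ hC hS).lDeltaTheta)
    (γΛ : D.lDeltaTheta l ≃* D.lDeltaTheta l)
    (hγΛ : ∀ (g : (C.thetaEnvTower τ hC hS).lDeltaTheta) (hg : γ g ∈ (C.thetaEnvTower τ hC hS).lDeltaTheta),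
      C.toLDelta ⟨γ g, hg⟩ = γΛ (C.toLDelta g))
    (γμ : (C.thetaEnvTower τ hC hS).mu M ≃* (C.thetaEnvTower τ hC hS).mu M)
    (hcompat : ∀ (g : (C.thetaEnvTower τ hC hS).lDeltaTheta) (hg : γ g ∈ (C.thetaEnvTower τ hC hS).lDeltaTheta),
      (C.thetaEnvTower τ hC hS).thetaMod M ⟨γ g, hg⟩ = γμ ((C.thetaEnvTower τ hC hS).thetaMod M g))
    (y : D.lDeltaTheta l) :
    γμ ((τ.mod M).red (γΛ.symm y)) = (τ.mod M).red y := by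
  obtain ⟨k, hk⟩ := C.toLDelta_onto' (γΛ.symm y)
  have h1 : (τ.mod M).red (γΛ.symm y) = (C.thetaEnvTower τ hC hS).thetaMod M k := by
    rw [← hk]; rfl
  rw [h1, C.thetaEnvTower_coeffAut_apply τ hC hS M γ hγL γμ hcompat k]
  change (τ.mod M).red (C.toLDelta ⟨γ k, hγL k⟩) = (τ.mod M).red y
  rw [hγΛ k (hγL k), hk, MulEquiv.apply_symm_apply]

/-- `γ(Π^tp_Ÿ̲̲) ⊆ Π^tp_Ÿ̲̲` from the clause `γ(Π^tp_Ÿ̲̲) = Π^tp_Ÿ̲̲` (tower currency).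
[cite: MochizukiEtTh2009, Cor 2.18 (i) p.60] -/
theorem apply_mem_PiYdd (hC : D.Compat) (hS : D.Sec2Hyps)
    (γ : (C.thetaEnvTower τ hC hS).PiX ≃ₜ* (C.thetaEnvTower τ hC hS).PiX)
    (hγ : (C.thetaEnvTower τ hC hS).PiYdd.map γ.toMulEquiv.toMonoidHom = (C.thetaEnvTower τ hC hS).PiYdd)
    (g : (C.thetaEnvTower τ hC hS).PiYdd) :
    γ (g : (C.thetaEnvTower τ hC hS).PiX) ∈ (C.thetaEnvTower τ hC hS).PiYdd := by
  have : γ (g : (C.thetaEnvTower τ hC hS).PiX) ∈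
      (C.thetaEnvTower τ hC hS).PiYdd.map γ.toMulEquiv.toMonoidHom := ⟨g, g.2, rfl⟩
  rwa [hγ] at this

/-- **G3 + G4 (the transport of `l·Δ_Θ`-valued cocycles along `γ`).** Let `γ` be a bi-continuous automorphism of
`Π^tp_X̲̲` stabilising `Π^tp_Ÿ̲̲` and the inverse image of `l·Δ_Θ`, `γ̃` an automorphism of `l·Δ_Θ` induced by `γ`
(`exists_lDeltaAut`).  For every `l·Δ_Θ`-valued continuous cocycle `f` on `Π^tp_Ÿ̲̲` there is an `l·Δ_Θ`-valued function
`F = Φ_γ f` on `Π^tp_Ÿ̲̲` with (a) `F(g) = γ̃⁻¹(f(γ g))`, (b) the COCYCLE LAW `F(gh) = F(g) · θ(g) F(h) θ(g)⁻¹` for the ORIGINAL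
action (equivariance of `γ̃`, `lDeltaAut_conj`), and (c) for every level `M` and every admitted `γ̄_M`, the reduction
`red_M ∘ F` IS abc-iut-L2-t2's `ThetaEnvTower.pullbackCocycle M γ hγ γ̄_M (red_M ∘ f)` (pinning, G4).
[cite: MochizukiEtTh2009, Cor 2.19(iii) p.65] -/
theorem exists_transport (hC : D.Compat) (hS : D.Sec2Hyps)
    (γ : (C.thetaEnvTower τ hC hS).PiX ≃ₜ* (C.thetaEnvTower τ hC hS).PiX)
    (hγ : (C.thetaEnvTower τ hC hS).PiYdd.map γ.toMulEquiv.toMonoidHom = (C.thetaEnvTower τ hC hS).PiYdd)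
    (hL : (C.thetaEnvTower τ hC hS).lDeltaTheta.map γ.toMulEquiv.toMonoidHom = (C.thetaEnvTower τ hC hS).lDeltaTheta)
    (γΛ : D.lDeltaTheta l ≃* D.lDeltaTheta l)
    (hγΛ : ∀ (g : (C.thetaEnvTower τ hC hS).lDeltaTheta) (hg : γ g ∈ (C.thetaEnvTower τ hC hS).lDeltaTheta),
      C.toLDelta ⟨γ g, hg⟩ = γΛ (C.toLDelta g))
    (f : contCocycles D.toTheta D.DeltaTheta C.GtpYdduu) (hf : ∀ g, (f.1 g : D.GtpTheta) ∈ D.lDeltaTheta l) :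
    ∃ F : C.GtpYdduu → D.lDeltaTheta l,
      (∀ g : (C.thetaEnvTower τ hC hS).PiYdd,
        F (C.inclYdduu g) =
          γΛ.symm ⟨(f.1 (C.inclYdduu ⟨γ g, C.apply_mem_PiYdd τ hC hS γ hγ g⟩) : D.GtpTheta), hf _⟩) ∧
      (∀ g h : C.GtpYdduu, (F (g * h) : D.GtpTheta) =
        (F g : D.GtpTheta) * (D.toTheta (g : D.PiTemp) * (F h : D.GtpTheta) * (D.toTheta (g : D.PiTemp))⁻¹)) ∧
      ∀ (M : Es) (γμ : (C.thetaEnvTower τ hC hS).mu M ≃* (C.thetaEnvTower τ hC hS).mu M)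
        (_ : ∀ (g : (C.thetaEnvTower τ hC hS).lDeltaTheta) (hg : γ g ∈ (C.thetaEnvTower τ hC hS).lDeltaTheta),
          (C.thetaEnvTower τ hC hS).thetaMod M ⟨γ g, hg⟩ = γμ ((C.thetaEnvTower τ hC hS).thetaMod M g)),
        (C.thetaEnvTower τ hC hS).pullbackCocycle M γ hγ γμ (C.modN (τ.mod M) f hf) =
          fun g => (τ.mod M).red (F (C.inclYdduu g)) := by
  -- clause (5) in the «maps into» form
  have hγL : ∀ g : (C.thetaEnvTower τ hC hS).lDeltaTheta,
      γ (g : (C.thetaEnvTower τ hC hS).PiX) ∈ (C.thetaEnvTower τ hC hS).lDeltaTheta := fun g => by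
    have : γ (g : (C.thetaEnvTower τ hC hS).PiX) ∈
        (C.thetaEnvTower τ hC hS).lDeltaTheta.map γ.toMulEquiv.toMonoidHom := ⟨g, g.2, rfl⟩
    rwa [hL] at this
  -- `Π^tp_Ÿ̲̲` read in `Π^tp_X̲̲` (tower currency) and the point `γ g` read back in `Π^tp_X`
  let ι : C.GtpYdduu → (C.thetaEnvTower τ hC hS).PiYdd := fun k =>
    ⟨⟨(k : D.PiTemp), (Subgroup.mem_inf.1 k.2).2⟩, (Subgroup.mem_inf.1 k.2).1⟩
  let γP : C.GtpYdduu → C.GtpYdduu := fun k => C.inclYdduu ⟨γ (ι k), C.apply_mem_PiYdd τ hC hS γ hγ (ι k)⟩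
  have hγP : ∀ k, ((γP k : C.GtpYdduu) : D.PiTemp) =
      ((γ ((ι k : (C.thetaEnvTower τ hC hS).PiYdd) : (C.thetaEnvTower τ hC hS).PiX) :
        (C.thetaEnvTower τ hC hS).PiX) : D.PiTemp) := fun k => rfl
  have hγP_mul : ∀ g h, γP (g * h) = γP g * γP h := fun g h => by
    apply Subtype.ext
    rw [Subgroup.coe_mul, hγP, hγP, hγP]
    have : (ι (g * h) : (C.thetaEnvTower τ hC hS).PiYdd) = ι g * ι h := Subtype.ext (Subtype.ext rfl)
    rw [this, Subgroup.coe_mul, map_mul, Subgroup.coe_mul]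
  refine ⟨fun k => γΛ.symm ⟨(f.1 (γP k) : D.GtpTheta), hf _⟩, fun g => rfl, fun g h => ?_, fun M γμ hcompat => ?_⟩
  · -- the cocycle law, from that of `f` at `γ g, γ h` and the equivariance of `γ̃`
    have hfgh : (⟨(f.1 (γP (g * h)) : D.GtpTheta), hf _⟩ : D.lDeltaTheta l) =
        ⟨(f.1 (γP g) : D.GtpTheta), hf _⟩ *
          ⟨D.toTheta ((γP g : C.GtpYdduu) : D.PiTemp) * (f.1 (γP h) : D.GtpTheta) *
              (D.toTheta ((γP g : C.GtpYdduu) : D.PiTemp))⁻¹,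
            (D.lDeltaTheta_normal l).conj_mem _ (hf _) _⟩ := by
      apply Subtype.ext
      change ((f.1 (γP (g * h)) : D.DeltaTheta) : D.GtpTheta) =
        ((f.1 (γP g) : D.DeltaTheta) : D.GtpTheta) *
          (D.toTheta ((γP g : C.GtpYdduu) : D.PiTemp) * ((f.1 (γP h) : D.DeltaTheta) : D.GtpTheta) *
            (D.toTheta ((γP g : C.GtpYdduu) : D.PiTemp))⁻¹)
      rw [hγP_mul, f.2.2, Subgroup.coe_mul, MulAut.conjNormal_apply]
    -- equivariance: `γ̃⁻¹(θ(γg) · b · θ(γg)⁻¹) = θ(g) · γ̃⁻¹(b) · θ(g)⁻¹`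
    have hconj := C.lDeltaAut_conj τ hC hS γ.toMulEquiv hL γΛ hγΛ
      ((ι g : (C.thetaEnvTower τ hC hS).PiYdd) : (C.thetaEnvTower τ hC hS).PiX)
      (γΛ.symm ⟨(f.1 (γP h) : D.GtpTheta), hf _⟩)
    rw [MulEquiv.apply_symm_apply] at hconj
    have hb : (⟨D.toTheta ((γP g : C.GtpYdduu) : D.PiTemp) * (f.1 (γP h) : D.GtpTheta) *
          (D.toTheta ((γP g : C.GtpYdduu) : D.PiTemp))⁻¹,
        (D.lDeltaTheta_normal l).conj_mem _ (hf _) _⟩ : D.lDeltaTheta l) =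
        γΛ ⟨D.toTheta ((g : C.GtpYdduu) : D.PiTemp) * (γΛ.symm ⟨(f.1 (γP h) : D.GtpTheta), hf _⟩ : D.GtpTheta) *
            (D.toTheta ((g : C.GtpYdduu) : D.PiTemp))⁻¹,
          (D.lDeltaTheta_normal l).conj_mem _ (γΛ.symm ⟨(f.1 (γP h) : D.GtpTheta), hf _⟩).2 _⟩ := by
      apply Subtype.ext
      rw [hconj, hγP]
      rfl
    dsimp only
    rw [hfgh, map_mul, Subgroup.coe_mul, hb, MulEquiv.symm_apply_apply]
  · -- the reduction mod `M` is the pulled-back cocycle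
    funext g
    change γμ.symm ((τ.mod M).red ⟨(f.1 (C.inclYdduu ⟨γ g, _⟩) : D.GtpTheta), hf _⟩) = (τ.mod M).red (γΛ.symm _)
    apply γμ.injective
    rw [MulEquiv.apply_symm_apply, C.coeffAut_red_lDeltaAut_symm τ hC hS M γ hγL γΛ hγΛ γμ hcompat]
    rfl


/-! ## §2. Transport laws (roadmap G5, G6): conjugates and coboundaries -/

/-- **`γ̃⁻¹` intertwines the conjugations through `γ`** (inverse form of `lDeltaAut_conj`):
`γ̃⁻¹(θ(γ k) · b · θ(γ k)⁻¹) = θ(k) · γ̃⁻¹(b) · θ(k)⁻¹`. [cite: MochizukiEtTh2009, Cor 2.18 (i) p.60] -/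
theorem lDeltaAut_symm_conj (hC : D.Compat) (hS : D.Sec2Hyps)
    (γ : (C.thetaEnvTower τ hC hS).PiX ≃ₜ* (C.thetaEnvTower τ hC hS).PiX)
    (hL : (C.thetaEnvTower τ hC hS).lDeltaTheta.map γ.toMulEquiv.toMonoidHom = (C.thetaEnvTower τ hC hS).lDeltaTheta)
    (γΛ : D.lDeltaTheta l ≃* D.lDeltaTheta l)
    (hγΛ : ∀ (g : (C.thetaEnvTower τ hC hS).lDeltaTheta) (hg : γ g ∈ (C.thetaEnvTower τ hC hS).lDeltaTheta),
      C.toLDelta ⟨γ g, hg⟩ = γΛ (C.toLDelta g))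
    (k : (C.thetaEnvTower τ hC hS).PiX) (b : D.lDeltaTheta l) :
    γΛ.symm ⟨D.toTheta ((γ k : (C.thetaEnvTower τ hC hS).PiX) : D.PiTemp) * (b : D.GtpTheta) *
        (D.toTheta ((γ k : (C.thetaEnvTower τ hC hS).PiX) : D.PiTemp))⁻¹, (D.lDeltaTheta_normal l).conj_mem _ b.2 _⟩ =
      ⟨D.toTheta (k : D.PiTemp) * (γΛ.symm b : D.GtpTheta) * (D.toTheta (k : D.PiTemp))⁻¹,
        (D.lDeltaTheta_normal l).conj_mem _ (γΛ.symm b).2 _⟩ := by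
  apply γΛ.injective
  rw [MulEquiv.apply_symm_apply]
  apply Subtype.ext
  have h := C.lDeltaAut_conj τ hC hS γ.toMulEquiv hL γΛ hγΛ k (γΛ.symm b)
  rw [MulEquiv.apply_symm_apply] at h
  exact h.symm

/-- **G5 (transport of a conjugate).** If `f' = conjRoot σ f` pointwise (`σ ∈ Π^tp_X̲̲`), then the transports satisfy
`Φ_γ f' = conjRoot (γ⁻¹σ) (Φ_γ f)` pointwise on `Π^tp_Ÿ̲̲`: transport along `γ` carries the `Π^tp_X̲̲`-orbit structure of the
root cocycles to itself, re-indexed by `γ⁻¹`. [cite: MochizukiEtTh2009, Cor 2.19(iii) p.65] -/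
theorem transport_conj (hC : D.Compat) (hS : D.Sec2Hyps)
    (γ : (C.thetaEnvTower τ hC hS).PiX ≃ₜ* (C.thetaEnvTower τ hC hS).PiX)
    (hγ : (C.thetaEnvTower τ hC hS).PiYdd.map γ.toMulEquiv.toMonoidHom = (C.thetaEnvTower τ hC hS).PiYdd)
    (hL : (C.thetaEnvTower τ hC hS).lDeltaTheta.map γ.toMulEquiv.toMonoidHom = (C.thetaEnvTower τ hC hS).lDeltaTheta)
    (γΛ : D.lDeltaTheta l ≃* D.lDeltaTheta l)
    (hγΛ : ∀ (g : (C.thetaEnvTower τ hC hS).lDeltaTheta) (hg : γ g ∈ (C.thetaEnvTower τ hC hS).lDeltaTheta),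
      C.toLDelta ⟨γ g, hg⟩ = γΛ (C.toLDelta g))
    (f f' : contCocycles D.toTheta D.DeltaTheta C.GtpYdduu)
    (hf : ∀ g, (f.1 g : D.GtpTheta) ∈ D.lDeltaTheta l) (hf' : ∀ g, (f'.1 g : D.GtpTheta) ∈ D.lDeltaTheta l)
    (σ : C.Huu)
    (hff' : ∀ g : C.GtpYdduu, f'.1 g = MulAut.conjNormal (D.toTheta (σ : D.PiTemp))
      (f.1 ⟨((σ : D.PiTemp))⁻¹ * (g : D.PiTemp) * (σ : D.PiTemp), C.conj_mem_GtpYdduu hC σ g⟩))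
    (F F' : C.GtpYdduu → D.lDeltaTheta l)
    (hF : ∀ g : (C.thetaEnvTower τ hC hS).PiYdd, F (C.inclYdduu g) =
      γΛ.symm ⟨(f.1 (C.inclYdduu ⟨γ g, C.apply_mem_PiYdd τ hC hS γ hγ g⟩) : D.GtpTheta), hf _⟩)
    (hF' : ∀ g : (C.thetaEnvTower τ hC hS).PiYdd, F' (C.inclYdduu g) =
      γΛ.symm ⟨(f'.1 (C.inclYdduu ⟨γ g, C.apply_mem_PiYdd τ hC hS γ hγ g⟩) : D.GtpTheta), hf' _⟩)
    (g : (C.thetaEnvTower τ hC hS).PiYdd)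
    (hmem : (γ.symm σ)⁻¹ * (g : (C.thetaEnvTower τ hC hS).PiX) * γ.symm σ ∈ (C.thetaEnvTower τ hC hS).PiYdd) :
    (F' (C.inclYdduu g) : D.GtpTheta) =
      D.toTheta ((γ.symm σ : (C.thetaEnvTower τ hC hS).PiX) : D.PiTemp) *
        (F (C.inclYdduu ⟨(γ.symm σ)⁻¹ * (g : (C.thetaEnvTower τ hC hS).PiX) * γ.symm σ, hmem⟩) : D.GtpTheta) *
        (D.toTheta ((γ.symm σ : (C.thetaEnvTower τ hC hS).PiX) : D.PiTemp))⁻¹ := by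
  rw [hF', hF]
  -- the point at which `f` is evaluated on both sides
  have hpt : (⟨((σ : D.PiTemp))⁻¹ * ((C.inclYdduu ⟨γ g, C.apply_mem_PiYdd τ hC hS γ hγ g⟩ : C.GtpYdduu) : D.PiTemp) *
        (σ : D.PiTemp), C.conj_mem_GtpYdduu hC σ _⟩ : C.GtpYdduu) =
      C.inclYdduu ⟨γ (⟨(γ.symm σ)⁻¹ * (g : (C.thetaEnvTower τ hC hS).PiX) * γ.symm σ, hmem⟩ :
        (C.thetaEnvTower τ hC hS).PiYdd), C.apply_mem_PiYdd τ hC hS γ hγ _⟩ := by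
    apply Subtype.ext
    change ((σ : D.PiTemp))⁻¹ * ((γ (g : (C.thetaEnvTower τ hC hS).PiX) : (C.thetaEnvTower τ hC hS).PiX) : D.PiTemp) *
        (σ : D.PiTemp) =
      ((γ ((γ.symm σ)⁻¹ * (g : (C.thetaEnvTower τ hC hS).PiX) * γ.symm σ) : (C.thetaEnvTower τ hC hS).PiX) : D.PiTemp)
    rw [map_mul, map_mul, map_inv, ContinuousMulEquiv.apply_symm_apply, Subgroup.coe_mul, Subgroup.coe_mul,
      Subgroup.coe_inv]
  have hval : (⟨(f'.1 (C.inclYdduu ⟨γ g, C.apply_mem_PiYdd τ hC hS γ hγ g⟩) : D.GtpTheta), hf' _⟩ : D.lDeltaTheta l) =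
      ⟨D.toTheta ((γ (γ.symm σ) : (C.thetaEnvTower τ hC hS).PiX) : D.PiTemp) *
          ((⟨(f.1 (C.inclYdduu ⟨γ (⟨(γ.symm σ)⁻¹ * (g : (C.thetaEnvTower τ hC hS).PiX) * γ.symm σ, hmem⟩ :
            (C.thetaEnvTower τ hC hS).PiYdd), C.apply_mem_PiYdd τ hC hS γ hγ _⟩) : D.GtpTheta), hf _⟩ :
              D.lDeltaTheta l) : D.GtpTheta) *
          (D.toTheta ((γ (γ.symm σ) : (C.thetaEnvTower τ hC hS).PiX) : D.PiTemp))⁻¹,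
        (D.lDeltaTheta_normal l).conj_mem _ (hf _) _⟩ := by
    apply Subtype.ext
    change ((f'.1 _ : D.DeltaTheta) : D.GtpTheta) = _
    rw [hff', MulAut.conjNormal_apply, hpt, ContinuousMulEquiv.apply_symm_apply]
  rw [hval, C.lDeltaAut_symm_conj τ hC hS γ hL γΛ hγΛ]

/-- **G6 (transport of a coboundary).** If `f = ∂d` pointwise with `d ∈ l·Δ_Θ` (`f(k) = θ(k) d θ(k)⁻¹ · d⁻¹`), then the
transport is the coboundary of `γ̃⁻¹ d`: `Φ_γ f (g) = θ(g) γ̃⁻¹(d) θ(g)⁻¹ · γ̃⁻¹(d)⁻¹` ("conjugation by an element of `μ_N`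
corresponds precisely to modifying a cocycle by a coboundary", p. 47). [cite: MochizukiEtTh2009, Def 2.13 p.47] -/
theorem transport_coboundary (hC : D.Compat) (hS : D.Sec2Hyps)
    (γ : (C.thetaEnvTower τ hC hS).PiX ≃ₜ* (C.thetaEnvTower τ hC hS).PiX)
    (hγ : (C.thetaEnvTower τ hC hS).PiYdd.map γ.toMulEquiv.toMonoidHom = (C.thetaEnvTower τ hC hS).PiYdd)
    (hL : (C.thetaEnvTower τ hC hS).lDeltaTheta.map γ.toMulEquiv.toMonoidHom = (C.thetaEnvTower τ hC hS).lDeltaTheta)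
    (γΛ : D.lDeltaTheta l ≃* D.lDeltaTheta l)
    (hγΛ : ∀ (g : (C.thetaEnvTower τ hC hS).lDeltaTheta) (hg : γ g ∈ (C.thetaEnvTower τ hC hS).lDeltaTheta),
      C.toLDelta ⟨γ g, hg⟩ = γΛ (C.toLDelta g))
    (f : contCocycles D.toTheta D.DeltaTheta C.GtpYdduu)
    (hf : ∀ g, (f.1 g : D.GtpTheta) ∈ D.lDeltaTheta l) (d : D.lDeltaTheta l)
    (hfd : ∀ k : C.GtpYdduu, (f.1 k : D.GtpTheta) =
      D.toTheta (k : D.PiTemp) * (d : D.GtpTheta) * (D.toTheta (k : D.PiTemp))⁻¹ * (d : D.GtpTheta)⁻¹)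
    (F : C.GtpYdduu → D.lDeltaTheta l)
    (hF : ∀ g : (C.thetaEnvTower τ hC hS).PiYdd, F (C.inclYdduu g) =
      γΛ.symm ⟨(f.1 (C.inclYdduu ⟨γ g, C.apply_mem_PiYdd τ hC hS γ hγ g⟩) : D.GtpTheta), hf _⟩)
    (g : (C.thetaEnvTower τ hC hS).PiYdd) :
    (F (C.inclYdduu g) : D.GtpTheta) =
      D.toTheta (((g : (C.thetaEnvTower τ hC hS).PiX)) : D.PiTemp) * (γΛ.symm d : D.GtpTheta) *
        (D.toTheta (((g : (C.thetaEnvTower τ hC hS).PiX)) : D.PiTemp))⁻¹ * ((γΛ.symm d : D.GtpTheta))⁻¹ := by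
  rw [hF]
  have hval : (⟨(f.1 (C.inclYdduu ⟨γ g, C.apply_mem_PiYdd τ hC hS γ hγ g⟩) : D.GtpTheta), hf _⟩ : D.lDeltaTheta l) =
      ⟨D.toTheta ((γ (g : (C.thetaEnvTower τ hC hS).PiX) : (C.thetaEnvTower τ hC hS).PiX) : D.PiTemp) * (d : D.GtpTheta) *
          (D.toTheta ((γ (g : (C.thetaEnvTower τ hC hS).PiX) : (C.thetaEnvTower τ hC hS).PiX) : D.PiTemp))⁻¹,
        (D.lDeltaTheta_normal l).conj_mem _ d.2 _⟩ * d⁻¹ := by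
    apply Subtype.ext
    rw [Subgroup.coe_mul, Subgroup.coe_inv]
    exact hfd _
  rw [hval, map_mul, map_inv, C.lDeltaAut_symm_conj τ hC hS γ hL γΛ hγΛ, Subgroup.coe_mul, Subgroup.coe_inv]

end ThetaSetting.EtaleThetaData.DoubleUnderline

end Literature.AnabelianGeometry.EtaleTheta

end
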